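import Mathlib.Tactic.Linarith
import Mathlib.Tactic.Ring
import Mathlib.Tactic.NormNum
import Mathlib.Tactic.FieldSimp
import Mathlib.Tactic.IntervalCases
import Mathlib.Tactic.LinearCombination
import Mathlib.Algebra.BigOperators.Fin
import Mathlib.Algebra.Order.BigOperators.Group.Finset
import HarnessLib

/-!
# The (0,1) cell of the ι-window, EXCLUSION side, V: torsion forced on every normal theta c.i. (`c_K = c_N`), the ι-fixed singular
# points of `S_a = Θ_a ∩ Θ_{-a}` read off the SECOND FUNDAMENTAL FORM of `Θ`, and the index criterion at an arbitrary fixed singular point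
# — arithmetic skeleton

Family `hodge`, layer `Literature/AlgebraicGeometry/HodgeTheory`. Companion to `SemiregularityIotaWindowVoid.lean` (pv1 gens 11–15: the H2
census, (TS), (TM), THEOREM (R-tan)) and `SemiregularityQuotSieveFixedNode.lean` (pv1-g16: THEOREM A/B, the uniform sieve, the hull types at a
fixed point of type A), SAME dictionary: `X` a very general ppav fourfold (`NS = ℤθ`, `Θ` smooth symmetric, not a Jacobian), `ι = −1`, a would-be
`(0,1)` object `F = ker(E ↠ T)` of shape (4.5)(a) with flat rank-2 hull `E`, support the theta complete intersection `S_a`, `N = (T/T₀)^{**}`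
rank-one reflexive on `S_a`, `K = ker(E_S ↠ T/T₀)`, `t = length T₀`, `ℓ = length(N/G)`, `c_K = Σ_w δ_w(K)`, `c_N = Σ_w δ_w(N)` the local
Riemann–Roch defects. Ladder note `papers/HodgeConjecture/hodge-weil-ladder` (packet `run/shared/lean/b2b/hodge-weil/`), CLAIM TABLE v26 (LADDER
C174) row pv1-g17, report `b2b-hweil-pv1-g17/H2-ZERO-ONE-5.md`, scripts `code/pv1-g17/` (corroboration / numerics only). Def-free, fully proved
ELEMENTARY statements; the geometry is in the docstrings and the report. HONEST FRAMING: census / negative results about one cell of the ladder's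
H2 test on the exclusion side; no case of the Hodge conjecture is proved; nothing here is a rung; no statement of [Markman 2025] is used; nothing
here depends on (LP) or on 'ker ob = ann(ch)'.

THEOREM 1 (report §1). On a NORMAL `S_a`, `K ≅ N^∨` (rank-one reflexive of class `−[N]`), so Serre duality on the Gorenstein surface gives
`c_K = c_N`; with THEOREM (R-tan)'s identities `ℓ = N² + c_K + c_N`, `N² = 2t − 4 − 2c_K` this yields `ℓ = 2t − 4` EXACTLY and `t ≥ 2`
(`torsion_forced_exact`): 0-dimensional torsion, hence an `ι`-fixed point on `S_a`, is forced for EVERY `a`, whatever the singularities. Hodge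
index `24·N² ≤ 256` then bounds `t ≤ 22/3 + c_N` (`budget_general`, `budget_seven`, `budget_eight`); at a rational double point the defect of a
Weil divisor is `½{c}² − h⁰(R¹π_*…) ≤ 0` (`rdp_defect_nonpos`), so `t ≥ 8` needs a NON-rational singular point carrying a non-Cartier `N` with
positive defect (at a simple-elliptic `Ẽ₇` point the index-0 classes have `δ = +1`, `e7tilde_defect`).

THEOREM 2 (report §2). For `x ∈ X[2]`, `a = x + b`, `b ∈ Θ ∖ X[2]`, the quadratic part of the even equation `q` of `(S_a, x) = V(x₄, q)` is the
second fundamental form `II_b` of `Θ` at `b`; corank `≥ 2` at `x` iff `rank II_b ≤ 1`. The Harris–Tu class of `{rank II ≤ 1}` for a symmetric form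
on a rank-3 bundle is `4(c₁c₂ − c₃)` of the half-twisted bundle; the identity with the un-twisted expression obtained from the kernel-plane
resolution is `harrisTu_rank3_rank_le_one`; on a smooth 3-dimensional theta divisor (`c(Ω_Θ) = 1 + θ + θ² + θ³`, twist `θ`) it evaluates to
`20·θ³`, degree `480` (`thetaFourfold_corank2_degree`), while the `2^{g−1}(2^g − 1) = 120` odd two-torsion points (`oddCharacteristics_four`) lie on
`Θ` with `II = 0` and contribute multiplicity `≥ 4` each when isolated (Fulton Cor. 12.4; the Veronese cone has degree 4): `480 = 120·4`
(`corank2_count_saturated`) — so IF `{rank II ≤ 1}` is finite it is exactly the set of odd two-torsion points, every `ι`-fixed singular point of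
every `S_a` is of type `A_{2m−1}`, and the residual (W)″ of `SemiregularityQuotSieveFixedNode` §14 is EMPTY. (`hessePencil_polar_rank_one`: on the
Hesse cubic `x³+y³+z³+6λxyz` a rank-≤1 polar quadric at a non-zero point forces `λ = 0` or `λ³ = 1` — the tangent-cone criterion for multiplicity
exactly 4.) Finiteness for the very general ppav fourfold is hypothesis (G) of the report (it fails on Jacobians); not claimed.

THEOREM 3 (report §3). Over `R = k[[x₁,x₂,x₃]]/(q)`, `q` even of order 2, a non-free rank-one MCM module has a `2 × 2` matrix factorisation `P`
with `det P₁ = u(0)·q₂ ≠ 0`; parities force the relation signs to be minus the generator signs, and the local index is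
`t_x = 2(sdim F₀ − sdim F₁) = 4(σ₁ + σ₂) ∈ {−8, 0, 8}`: index 0 iff the two generators have opposite signs (`index_criterion`,
`index_values`). Hence the balance lemma and the hull types NB/+/−/d of `SemiregularityQuotSieveFixedNode` §14 hold at EVERY fixed singular point of
corank `≤ 2`, and the sieve kills every configuration with `t_x ≤ 6` there.

What is NOT here: sheaves, theta functions, the proofs of THEOREMS 1–3 (report), hypothesis (G). 0 unconditional rungs above the floor.
-/

namespace Literature.AlgebraicGeometry.HodgeTheory

section H2ThetaSecondFundamentalForm

open Finset BigOperators

/-- THEOREM 1, arithmetic core (report §1.1 (iii)): THEOREM (R-tan)'s two identities `ℓ = N² + c_K + c_N` and `N² = 2t − 4 − 2c_K`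
together with the duality `c_K = c_N` (report THEOREM 1: `K ≅ N^∨` and Serre duality on the Gorenstein surface `S_a`) give `ℓ = 2t − 4`
exactly; since `ℓ ≥ 0` is a colength, `t ≥ 2`: the 0-dimensional torsion is non-zero on EVERY normal theta c.i., whatever its singularities. [folklore] -/
theorem torsion_forced_exact (t ℓ : ℤ) (N2 cK cN : ℚ)
    (h1 : (ℓ : ℚ) = N2 + cK + cN) (h2 : N2 = 2 * t - 4 - 2 * cK) (h3 : cK = cN) (hℓ : 0 ≤ ℓ) :
    ℓ = 2 * t - 4 ∧ 2 ≤ t := by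
  have key : (ℓ : ℚ) = 2 * t - 4 := by rw [h1, h2, h3]; ring
  have key' : ℓ = 2 * t - 4 := by exact_mod_cast key
  refine ⟨key', ?_⟩
  omega

/-- THE BUDGET (report §1.3): Hodge index on the normal surface `S_a` (`θ_S² = 24`, `N·θ_S = 16`) reads `24·N² ≤ 256`; with
`N² = 2t − 4 − 2c_N` (after `c_K = c_N`) this is `t ≤ 22/3 + c_N`. [folklore] -/
theorem budget_general (t : ℤ) (N2 cN : ℚ) (h2 : N2 = 2 * t - 4 - 2 * cN) (hHI : 24 * N2 ≤ 256) :
    (t : ℚ) ≤ 22 / 3 + cN := by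
  rw [h2] at hHI
  linarith

/-- The budget with non-positive defect (every singular point carrying a non-Cartier `N` rational): `t ≤ 7` — the standing bound of
THEOREM 4.2 / (R-node) / `hodgeBudget_seven`, now for every normal `S_a`. [folklore] -/
theorem budget_seven (t : ℤ) (N2 cN : ℚ) (h2 : N2 = 2 * t - 4 - 2 * cN) (hHI : 24 * N2 ≤ 256) (hc : cN ≤ 0) :
    t ≤ 7 := by
  have h := budget_general t N2 cN h2 hHI
  have : (t : ℚ) < 8 := by linarith
  have : t < 8 := by exact_mod_cast this
  omega

/-- The budget with defect at most `4/3` (e.g. ONE simple-elliptic index-0 class, `δ = 1`, report §3.6): `t ≤ 8`, i.e. torsion length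
`t_x = 2n` with `n ≤ 4` at a corank-2 fixed point — one step beyond the range `n ≤ 3` of the certified sieve; the surviving local
configuration is the report's (W)″₈. [folklore] -/
theorem budget_eight (t : ℤ) (N2 cN : ℚ) (h2 : N2 = 2 * t - 4 - 2 * cN) (hHI : 24 * N2 ≤ 256) (hc : cN ≤ 4 / 3) :
    t ≤ 8 := by
  have h := budget_general t N2 cN h2 hHI
  have : (t : ℚ) < 9 := by linarith
  have : t < 9 := by exact_mod_cast this
  omega

/-- THE SIGN OF THE DEFECT AT A RATIONAL DOUBLE POINT (report §1.4): with `𝒪_S(D) = π_*𝒪(D̃ + ⌊c⌋)` and Leray/Riemann–Roch on the minimal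
resolution, `δ_w(D) = ½({c}² + {c}·Δ) + p_g − h⁰(R¹π_*)`; at a rational double point `Δ = 0`, `p_g = 0` and `{c}² ≤ 0` (negative
definiteness), so `δ_w(D) ≤ 0`. The arithmetic shape: [folklore] -/
theorem rdp_defect_nonpos (csq : ℚ) (h1 : ℕ) (hneg : csq ≤ 0) : csq / 2 + 0 - (h1 : ℚ) ≤ 0 := by
  have : (0 : ℚ) ≤ h1 := by exact_mod_cast Nat.zero_le h1
  linarith

/-- THE SIMPLE-ELLIPTIC EXAMPLE (report §3.6): at an `Ẽ₇` point (`p_g = 1`, `K̃ = π^*K − E`) the index-0 non-Cartier class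
`D = C_i + C_j` has INTEGRAL pull-back (`{c} = 0`) and `R¹π_*𝒪(π^*D) = 0` (its restriction to `E` is a non-trivial 2-torsion line bundle),
so `δ = 0 + 1 − 0 = 1 > 0`: the budget becomes `t ≤ 8`. [folklore] -/
theorem e7tilde_defect : (0 : ℚ) / 2 + 1 - (0 : ℕ) = 1 ∧ (0 : ℚ) < 1 := by norm_num

/-- THEOREM 2, THE UNIVERSAL CLASS (report §2.2): for a symmetric form on a rank-3 bundle with values in a line bundle (Chern classes
`c₁,c₂,c₃`, `l`), the kernel-plane resolution gives `[rank ≤ 1] = 4(c₁c₂ − c₃) + 4c₁²l + 4c₂l + 8c₁l² + 4l³` (script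
`chern_rank1_locus.py`, exact push-forward from `ℙ(Ω)`), and this IS Harris–Tu's `4(c₁'c₂' − c₃')` for the half-twisted bundle
(`c₁' = c₁ + 3l/2`, `c₂' = c₂ + c₁l + 3l²/4`, `c₃' = c₃ + c₂l/2 + c₁l²/4 + l³/8`). The identity of the two expressions: [folklore] -/
theorem harrisTu_rank3_rank_le_one (c1 c2 c3 l : ℚ) :
    4 * ((c1 + 3 * l / 2) * (c2 + c1 * l + 3 * l ^ 2 / 4) - (c3 + c2 * l / 2 + c1 * l ^ 2 / 4 + l ^ 3 / 8))
      = 4 * (c1 * c2 - c3) + 4 * c1 ^ 2 * l + 4 * c2 * l + 8 * c1 * l ^ 2 + 4 * l ^ 3 := by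
  ring

/-- THEOREM 2, EVALUATION (report §2.3): on the smooth theta divisor of a ppav fourfold, `c(Ω_Θ) = (1 − θ)^{-1} = 1 + θ + θ² + θ³` and the
twist is `l = θ`, so all of `c₁c₂, c₃, c₁²l, c₂l, c₁l², l³` equal `θ³`: the class of `{rank II ≤ 1}` is `(4·(1−1) + 4 + 4 + 8 + 4)θ³ = 20θ³`,
of degree `20·θ⁴ = 20·24 = 480`. [folklore] -/
theorem thetaFourfold_corank2_degree :
    4 * ((1:ℤ) * 1 - 1) + 4 * 1 ^ 2 * 1 + 4 * 1 * 1 + 8 * 1 * 1 ^ 2 + 4 * 1 ^ 3 = 20 ∧ (20:ℤ) * 24 = 480 := by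
  norm_num

/-- The number of odd theta characteristics in genus `g` is `2^{g−1}(2^g − 1)`; for `g = 4` this is `120` (and `136` even ones,
`120 + 136 = 256 = 2^8`). On a smooth symmetric `Θ` these are exactly the two-torsion points of `Θ`, and `II` vanishes there (the local
equation is an odd function). [folklore] -/
theorem oddCharacteristics_four : 2 ^ (4 - 1) * (2 ^ 4 - 1) = 120 ∧ 120 + 136 = 2 ^ 8 := by norm_num

/-- THEOREM 2, THE SATURATED COUNT (report §2.5): the degeneracy class has degree `480`; each of the `120` odd two-torsion points, if
isolated in `D₁ = {rank II ≤ 1}`, has intersection multiplicity `≥ 4` (Fulton Cor. 12.4: the cone over the Veronese surface has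
multiplicity 4 at its vertex); so if `D₁` is finite, the sum of the multiplicities of the remaining points is `≤ 480 − 120·4 = 0`: there
are none, and each odd point has multiplicity exactly 4. Integer form: [folklore] -/
theorem corank2_count_saturated (m : Fin 120 → ℕ) (r : ℕ) (hm : ∀ i, 4 ≤ m i)
    (htot : (∑ i, m i) + r = 480) : r = 0 ∧ ∀ i, m i = 4 := by
  have hsum : 480 ≤ ∑ i, m i := by
    calc 480 = ∑ _i : Fin 120, 4 := by simp
      _ ≤ ∑ i, m i := Finset.sum_le_sum (fun i _ => hm i)
  have hr : r = 0 := by omega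
  refine ⟨hr, ?_⟩
  by_contra hne
  push Not at hne
  obtain ⟨i, hi⟩ := hne
  have hi' : 4 < m i := lt_of_le_of_ne (hm i) (Ne.symm hi)
  have hlt : ∑ _i : Fin 120, (4:ℕ) < ∑ i, m i :=
    Finset.sum_lt_sum (fun j _ => hm j) ⟨i, Finset.mem_univ i, hi'⟩
  have h480 : ∑ _i : Fin 120, (4:ℕ) = 480 := by simp
  omega

/-- THE TANGENT-CONE CRITERION AT AN ODD POINT (report §2.4): on the Hesse cubic `f = x³ + y³ + z³ + 6λxyz` the Hessian matrix at
`(x,y,z)` is `6·[[x, λz, λy],[λz, y, λx],[λy, λx, z]]`; its `2 × 2` minors vanish (a rank-≤1 polar quadric) at a NON-ZERO point only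
if `λ = 0` (Fermat) or `λ³ = 1` — both of `j`-invariant 0. So for a cubic outside this set the odd point is an isolated point of `D₁` of
multiplicity exactly 4. [folklore] -/
theorem hessePencil_polar_rank_one {K : Type*} [Field K] (lam x y z : K) (hlam : lam ≠ 0) (hlam3 : lam ^ 3 ≠ 1)
    (m12 : lam * x ^ 2 - lam ^ 2 * (y * z) = 0)
    (m22 : lam ^ 2 * (x * z) - lam * y ^ 2 = 0) (m33 : lam * z ^ 2 - lam ^ 2 * (x * y) = 0)
    (m44 : y * z - lam ^ 2 * x ^ 2 = 0) : x = 0 ∧ y = 0 ∧ z = 0 := by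
  -- the six distinct 2 × 2 minors of [[x, λz, λy],[λz, y, λx],[λy, λx, z]] are (xy − λ²z²), m12, (xz − λ²y²), m22, m33, m44 (up to
  -- sign); four of them suffice.  From m12 (λ ≠ 0): x² = λyz; with m44: x² = λ³x², so x = 0; then m22, m33 give y = z = 0.
  have h1 : x ^ 2 = lam * (y * z) := by
    have : lam * (x ^ 2 - lam * (y * z)) = 0 := by linear_combination m12
    have := (mul_eq_zero.mp this).resolve_left hlam
    linear_combination this
  have hx2 : (1 - lam ^ 3) * x ^ 2 = 0 := by
    have h6 : y * z = lam ^ 2 * x ^ 2 := by linear_combination m44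
    have : x ^ 2 = lam ^ 3 * x ^ 2 := by
      calc x ^ 2 = lam * (y * z) := h1
        _ = lam * (lam ^ 2 * x ^ 2) := by rw [h6]
        _ = lam ^ 3 * x ^ 2 := by ring
    linear_combination this
  have h1m : (1 - lam ^ 3) ≠ 0 := sub_ne_zero.mpr (Ne.symm hlam3)
  have hx : x = 0 := by
    have : x ^ 2 = 0 := (mul_eq_zero.mp hx2).resolve_left h1m
    exact pow_eq_zero_iff (n := 2) (by norm_num) |>.mp this
  subst hx
  have hy : y = 0 := by
    have : lam * y ^ 2 = 0 := by linear_combination -m22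
    have : y ^ 2 = 0 := (mul_eq_zero.mp this).resolve_left hlam
    exact pow_eq_zero_iff (n := 2) (by norm_num) |>.mp this
  subst hy
  have hz : z = 0 := by
    have : lam * z ^ 2 = 0 := by linear_combination m33
    have : z ^ 2 = 0 := (mul_eq_zero.mp this).resolve_left hlam
    exact pow_eq_zero_iff (n := 2) (by norm_num) |>.mp this
  exact ⟨rfl, rfl, hz⟩

/-- THEOREM 3, THE INDEX CRITERION (report §3.1 (c)(d)): a non-free rank-one MCM module over the even double point `R = B₀/(q)`,
`ord q = 2`, has two sign-homogeneous minimal generators (signs `σ₁, σ₂ ∈ {±1}`) and two minimal relations whose signs are `−σ₁, −σ₂`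
(parities forced by `det P₁ = u(0)·q₂ ≠ 0`); Koszul in `x₄` doubles the graded Euler characteristic, so the local index is
`t_x(i_*N) = 2((σ₁ + σ₂) − (−σ₁ − σ₂)) = 4(σ₁ + σ₂)`, which vanishes iff `σ₂ = −σ₁`: INDEX 0 ⟺ GENERATORS OF OPPOSITE SIGNS. [folklore] -/
theorem index_criterion (σ₁ σ₂ : ℤ) (h1 : σ₁ = 1 ∨ σ₁ = -1) (h2 : σ₂ = 1 ∨ σ₂ = -1) :
    2 * ((σ₁ + σ₂) - (-σ₁ + -σ₂)) = 4 * (σ₁ + σ₂) ∧ (4 * (σ₁ + σ₂) = 0 ↔ σ₂ = -σ₁) := by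
  refine ⟨by ring, ?_⟩
  rcases h1 with h1 | h1 <;> rcases h2 with h2 | h2 <;> subst h1 <;> subst h2 <;> omega

/-- The possible values of the index of 3.1 (d): `4(σ₁ + σ₂) ∈ {−8, 0, 8}` — consistent with the certified table at `A_{2m−1}`
(`indexTable_A_even/odd`: `0` for `M_j`, `j` even; `−8` for `j` odd with the linearisation induced from `R`; `+8` for the other one, which is
the dual's, 3.1 (e)). [folklore] -/
theorem index_values (σ₁ σ₂ : ℤ) (h1 : σ₁ = 1 ∨ σ₁ = -1) (h2 : σ₂ = 1 ∨ σ₂ = -1) :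
    4 * (σ₁ + σ₂) = -8 ∨ 4 * (σ₁ + σ₂) = 0 ∨ 4 * (σ₁ + σ₂) = 8 := by
  rcases h1 with h1 | h1 <;> rcases h2 with h2 | h2 <;> subst h1 <;> subst h2 <;> omega

/-- THEOREM 3 ⟹ the hull types (report §3.3 = `SemiregularityQuotSieveFixedNode` 14.4 (c)(d) without 'type A'): with `μ(M₀) = 2 + [c₊ = 0] +
[c₋ = 0] ∈ {2,3,4}` the hull `M` has `μ(M) = μ(M₀) + 2` minimal generators and `β₁ = 2μ(M₀) − 2` minimal relations, i.e.
`(Σm, Σρ) ∈ {(4,2), (5,4), (6,6)}` — the types NB, ±, d of the decision table (`betaOne_hull`, `decisionTable_uniform`). [folklore] -/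
theorem hullTypes_general (μ0 : ℕ) (h : μ0 = 2 ∨ μ0 = 3 ∨ μ0 = 4) :
    (μ0 + 2 = 4 ∧ 2 * μ0 - 2 = 2) ∨ (μ0 + 2 = 5 ∧ 2 * μ0 - 2 = 4) ∨ (μ0 + 2 = 6 ∧ 2 * μ0 - 2 = 6) := by
  rcases h with h | h | h <;> subst h <;> omega

/-- THE RESIDUAL (W)″₈ (report §3.6): at a simple-elliptic fixed point with `N_x` non-Cartier of index 0, `δ_x = 1`, the budget gives
`t ≤ 8`; the sieve (THEOREM 3) kills `t_x = 2n ≤ 6`; with all torsion at `x` (THEOREM 1: `t = t_x ≥ 2`, even by balance) the only value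
left is `t = 8`, whence `N² = 2·8 − 4 − 2·1 = 10`, `ℓ = 2·8 − 4 = 12`, Hodge index `24·10 = 240 ≤ 256` is NOT violated, and the class
`D = 3N − 2θ_S` has `D·θ_S = 3·16 − 2·24 = 0`, `D² = 9·10 − 12·16 + 4·24 = −6`. [folklore] -/
theorem residual_W8 (t : ℤ) (ht : t ≤ 8) (heven : t % 2 = 0) (hkill : ¬ (2 ≤ t ∧ t ≤ 6)) (hpos : 2 ≤ t) :
    t = 8 ∧ 2 * (8:ℤ) - 4 - 2 * 1 = 10 ∧ 2 * (8:ℤ) - 4 = 12 ∧ (24:ℤ) * 10 ≤ 256 ∧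
      3 * (16:ℤ) - 2 * 24 = 0 ∧ 9 * (10:ℤ) - 12 * 16 + 4 * 24 = -6 := by
  refine ⟨by omega, by norm_num, by norm_num, by norm_num, by norm_num, by norm_num⟩

end H2ThetaSecondFundamentalForm

section H2ThetaPositivity

/-!
### Addendum (same seat, report §2.6–2.7): positivity and the certificate

THEOREM 2′: `V = Sym²Ω_Θ ⊗ 𝒪_Θ(Θ)` is a quotient of `𝒪_Θ(Θ)^{⊕10}`, hence AMPLE, so in Fulton's canonical decomposition
`II^![𝒞] = Σ mᵢ αᵢ` every distinguished variety contributes a POSITIVE integer (Fulton, Intersection Theory, Thm. 12.1 (d); Fulton–Lazarsfeld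
1983); the 120 odd two-torsion points, when isolated in `D₁ = {rank II ≤ 1}` (tangent-cone criterion (G1): Aronhold `S ≠ 0` for the tangent
cubic), contribute exactly 4 each; `480 = 480 + Σ(positive)` leaves no further distinguished variety: `D₁ = Θ ∩ X[2]` — no finiteness
assumption. THEOREM 2″: (G1) is open in the period matrix and is certified by ball arithmetic at one explicit `τ₀ = RE16/16 + i·IM8/8`
(`IM8 = I·8 + S`, `S` symmetric with entries in `{−1,0,1}`, so `λ_min(Im τ₀) ≥ 1/2` by Gershgorin — the row bounds below); the job of record (report
§6.3, kit j067848, python-flint/Arb, 160 bits, `15⁴` lattice terms per characteristic plus a closed-form tail bound) certified `S(c_p) ≠ 0` for ALL 120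
odd characteristics (min certified `|S| = 1.1657·10⁻²` on cubics normalised to max coefficient 1, ball radii `≤ 3.2·10⁻²¹`); hence
`D₁(X) = Θ ∩ X[2]` for the general ppav fourfold and the residual (W)″ of the theta-c.i. family is EMPTY there.
-/

/-- THEOREM 2′, the final count (report §2.6 (iv)): if the 120 isolated odd points contribute `4` each, the total degeneracy degree is `480`,
and every further distinguished variety contributes a positive integer (ampleness), then there is no further distinguished variety. [folklore] -/
theorem positivity_leaves_no_room {ι : Type*} (s : Finset ι) (c : ι → ℕ) (hpos : ∀ i ∈ s, 0 < c i)
    (htot : 120 * 4 + s.sum c = 480) : s = ∅ := by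
  have hsum : s.sum c = 0 := by omega
  rw [Finset.sum_eq_zero_iff] at hsum
  by_contra hne
  obtain ⟨i, hi⟩ := Finset.nonempty_iff_ne_empty.mpr hne
  have := hpos i hi
  have := hsum i hi
  omega

/-- The rank bookkeeping of report §2.2: `V = Sym²Ω_Θ ⊗ L` has rank `3·4/2 = 6`, the kernel-plane resolution lives on the `2`-dimensional
fibres of `ℙ(Ω_Θ)` over the `3`-fold `Θ` (total `5`), the quotient bundle `W = V/(𝒮² ⊗ L)` has rank `6 − 1 = 5 = dim ℙ(Ω_Θ)` (so the expected
dimension of the resolved locus is `0`), the cone of rank-≤1 forms has dimension `3 = 6 − 3` (codimension `3 = dim Θ`), and `V` is a quotient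
of `𝒪(Θ)^{⊕10}`, `10 = 4·5/2 = rank Sym²(𝒪⁴)`. [folklore] -/
theorem rank_bookkeeping_II :
    3 * 4 / 2 = 6 ∧ 3 + 2 = 5 ∧ 6 - 1 = 5 ∧ 6 - 3 = 3 ∧ 4 * 5 / 2 = 10 := by norm_num

/-- Gershgorin rows for `Im τ₀ = (I·8 + S)/8` with the explicit `S` of the certificate (report §6.3,
`IM8 = [[8,1,−1,0],[1,8,1,−1],[−1,1,8,1],[0,−1,1,8]]`): each diagonal entry minus the sum of the moduli of the off-diagonal entries of its
row is `≥ 4`, so `λ_min(Im τ₀) ≥ 4/8 = 1/2` — the constant used in the tail bound of the truncated theta series. [folklore] -/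
theorem gershgorin_rows_tau0 :
    (8:ℤ) - (|1| + |(-1)| + |0|) ≥ 4 ∧ (8:ℤ) - (|1| + |1| + |(-1)|) ≥ 4 ∧
    (8:ℤ) - (|(-1)| + |1| + |1|) ≥ 4 ∧ (8:ℤ) - (|0| + |(-1)| + |1|) ≥ 4 ∧ (4:ℚ) / 8 = 1 / 2 := by
  norm_num

/-- The truncation of the certificate: lattice points `n ∈ ℤ⁴` with `|nᵢ| ≤ R = 7` number `15⁴ = 50625` per characteristic, and there are
`120` odd characteristics: `120 · 50625 = 6 075 000` terms of the third-derivative series are summed in ball arithmetic. [folklore] -/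
theorem certificate_term_count : (2 * 7 + 1) ^ 4 = 50625 ∧ 120 * 50625 = 6075000 := by norm_num

end H2ThetaPositivity

section H2ThetaNrmTorsion

/-- PROPOSITION 4.5 of the report (non-normal theta c.i. ⟹ `2a` torsion), the arithmetic: if `Θ_a, Θ_{−a}` are tangent along a curve `Γ` of
class `k·θ³/6`, the conormal line bundles agree along `Γ`, so `P_{φ(2a)}|_Γ` is trivial and `2a ∈ X[k]` (`ψ_Γ ∘ φ_Θ = ±k`, Matsusaka–Ran gives
`k ≥ 2`); the bound `k ≤ 9`: the c.i. curve `C = S_a ∩ Θ_e` has `2p_a − 2 = 3·24 = 72`, `p_a = 37`, class `6·(θ³/6)` with components of classes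
`k_i ≥ 2`, hence `r ≤ 3` components, `δ(C) ≤ p_a − 1 + r ≤ 39`, while the `Γ·θ = 4k` points of `Γ ∩ Θ_e` are singular on `C`: `4k ≤ 39`, so
`k ≤ 9`; with two distinct double curves `Γ ≠ ιΓ`: `8k ≤ 39`, `k ≤ 4`. [folklore] -/
theorem nrm_torsion_bounds (k r pa δ : ℕ) (hpa : 2 * pa - 2 = 3 * 24) (hr1 : 1 ≤ r) (hr : 2 * r ≤ 6)
    (hδ : δ ≤ pa - 1 + r) (hk : 4 * k ≤ δ) : pa = 37 ∧ r ≤ 3 ∧ k ≤ 9 ∧ (8 * k ≤ δ → k ≤ 4) := by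
  refine ⟨by omega, by omega, by omega, fun h8 => by omega⟩

/-- The intersection number used in 4.5 (iii): a curve of class `k·θ³/6` on a ppav fourfold meets a theta translate in `k·θ⁴/6 = k·24/6 = 4k`
points, and the c.i. curve of three theta translates has class `θ³ = 6·(θ³/6)` (`24 = 6·4`). [folklore] -/
theorem nrm_intersection_numbers (k : ℕ) : k * 24 / 6 = 4 * k ∧ 24 / 6 * 6 = 24 := by
  constructor <;> omega

end H2ThetaNrmTorsion

end Literature.AlgebraicGeometry.HodgeTheory
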